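import Literature.Analysis.FluidPDE.KNSSLineInvariantLiouville
import HarnessLib

/-!
# Scenario census, row A7hb — part «VorticityFlux»: a third curl component in the class of KNSS Lemma 2.1
# is `≤ 0` (Green's formula on horizontal squares)

Re-homed for the scenario census (typer seat ns-census-typer-1 g5; lead ORDER 2026-08-28T14:43Z) = the port-ready extract 1/2
(sha16 c26a0f5054fd2945, verbatim + three docstrings) of the REV 6 → REV 7 delta of ns-idea-2 g9's LINE «horizontal-meter»
(line file sha16 1474c686879270a9; evidence ⟨stmt-NavierStokesRegularity-10661⟩ n_evidence 51/53), written against the tree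
(Literature imports only; no census definition is used in this part).  Proposed tree path
`Summits/NavierStokesRegularity/NavierStokesRegularity/Theorems/ScenarioCensusRowA7hbVorticityFlux.lean`,
namespace `…ScenarioCensus.HorizontalMeter.B1`.

PROVED here (standard axioms), KNSS 2009 Theorem 5.1's step (3) ONE DIMENSION UP:
* `curlThird_square_bound` — if `V ∈ C¹(ℝ³; ℝ³)`, `‖V‖ ≤ K`, and `(curl V)₂ ≥ m` on the horizontal square
  `y₁ + [−r, r]e₀ + [−r, r]e₁`, then `m (2r)² ≤ 8 K r` (Mathlib `integral2_divergence_prod_of_hasFDerivAt` with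
  `f = V₁ ∘ chart`, `g = −V₀ ∘ chart`; four edge integrals `≤ 2rK` each);
* `curlThird_nonpos_of_lemma21` — the tree's `directionalDeriv_nonpos_of_lemma21` (KNSSLineInvariantPlanar) with
  the one-dimensional flux bound replaced by the square bound: a scalar in the class of Lemma 2.1
  (`KNSS2009_lemma21_halfball_holds`) whose slices are third curl components of `C¹` fields bounded by `K` is
  `≤ 0` (else balls of every radius `R` with `f ≥ M₁/2`, and the square of half-side `R/4` inside gives
  `M₁ R ≤ 16 K`).
No census value is asserted; NS regularity is NOT proved; no summit statement is proved by this file.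
-/

set_option linter.dupNamespace false

noncomputable section

namespace Summit.NavierStokesRegularity.NavierStokesRegularity.Theorems.ScenarioCensus.HorizontalMeter

open Set Function Filter Topology MeasureTheory
open scoped RealInnerProductSpace InnerProductSpace NNReal Laplacian
open Literature.Analysis Literature.Analysis.FluidPDE
open InnerProductSpace WithLp intervalIntegral
open scoped ContDiff

namespace B1

/-! ### Green's formula on a horizontal square: the flux bound for a third curl component -/

/-- The horizontal square chart through `y₁`: `sqPt y₁ (a, b) = y₁ + a e₀ + b e₁`. [folklore] -/
def sqPt (y₁ : (EuclideanSpace ℝ (Fin 3))) (p : ℝ × ℝ) : (EuclideanSpace ℝ (Fin 3)) :=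
  y₁ + p.1 • EuclideanSpace.single 0 (1 : ℝ) + p.2 • EuclideanSpace.single 1 (1 : ℝ)

/-- Its linear part. [folklore] -/
def sqL : ℝ × ℝ →L[ℝ] (EuclideanSpace ℝ (Fin 3)) :=
  (ContinuousLinearMap.fst ℝ ℝ ℝ).smulRight (EuclideanSpace.single 0 (1 : ℝ)) +
    (ContinuousLinearMap.snd ℝ ℝ ℝ).smulRight (EuclideanSpace.single 1 (1 : ℝ))

/-- Unfolding the linear part of the square chart. [folklore] -/
theorem sqL_apply (p : ℝ × ℝ) :
    sqL p = p.1 • EuclideanSpace.single 0 (1 : ℝ) + p.2 • EuclideanSpace.single 1 (1 : ℝ) := by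
  simp [sqL]

/-- The square chart is affine with derivative `sqL`. [folklore] -/
theorem hasFDerivAt_sqPt (y₁ : (EuclideanSpace ℝ (Fin 3))) (p : ℝ × ℝ) : HasFDerivAt (sqPt y₁) sqL p := by
  have h : sqPt y₁ = fun q => sqL q + y₁ := by
    funext q; rw [sqL_apply, sqPt]; abel
  rw [h]
  exact sqL.hasFDerivAt.add_const y₁

/-- The square chart is continuous. [folklore] -/
theorem continuous_sqPt (y₁ : (EuclideanSpace ℝ (Fin 3))) : Continuous (sqPt y₁) :=
  continuous_iff_continuousAt.2 fun p => (hasFDerivAt_sqPt y₁ p).continuousAt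

/-- `curl (−V) = −curl V`. [folklore] -/
theorem curl_fun_neg' (V : (EuclideanSpace ℝ (Fin 3)) → (EuclideanSpace ℝ (Fin 3))) (x : (EuclideanSpace ℝ (Fin 3))) : curl (fun y => -V y) x = -curl V x := by
  have h : fderiv ℝ (fun y => -V y) x = -fderiv ℝ V x := fderiv_fun_neg
  ext i
  fin_cases i <;> simp [curl, h] <;> ring

/-- A component bound. [folklore] -/
theorem abs_apply_le_of_norm_le {V : (EuclideanSpace ℝ (Fin 3)) → (EuclideanSpace ℝ (Fin 3))} {K : ℝ} (hK : ∀ x, ‖V x‖ ≤ K) (x : (EuclideanSpace ℝ (Fin 3))) (i : Fin 3) :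
    |V x i| ≤ K := by
  have h : ‖V x i‖ ≤ ‖V x‖ := PiLp.norm_apply_le (V x) i
  rw [Real.norm_eq_abs] at h
  exact h.trans (hK x)

/-- **The surface estimate on a horizontal square (KNSS 2009, proof of Thm 5.1, step (3), one
dimension up).** If `V ∈ C¹((EuclideanSpace ℝ (Fin 3)); (EuclideanSpace ℝ (Fin 3)))` has `‖V‖ ≤ K` and its third curl component is `≥ m` on the
horizontal square `y₁ + [−r, r]e₀ + [−r, r]e₁`, then `m (2r)² ≤ 8 K r`: by Green's formula on the
square, `∫∫ (∂₀V₁ − ∂₁V₀) = ∮ (V₁ dx₁ + V₀ dx₀-terms)`, four edge integrals each `≤ 2rK`. [cite: KochNadirashviliSereginSverak2009, proof of Thm 5.1, surface vs volume estimate (arXiv p. 9)] -/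
theorem curlThird_square_bound {V : (EuclideanSpace ℝ (Fin 3)) → (EuclideanSpace ℝ (Fin 3))} (hV : ContDiff ℝ 1 V) {K m r : ℝ}
    (hK : ∀ x, ‖V x‖ ≤ K) (hr : 0 ≤ r) {y₁ : (EuclideanSpace ℝ (Fin 3))}
    (hm : ∀ p ∈ Icc (-r) r ×ˢ Icc (-r) r, m ≤ curl V (sqPt y₁ p) 2) :
    m * (2 * r) ^ 2 ≤ 8 * K * r := by
  have hVd : ∀ x, HasFDerivAt V (fderiv ℝ V x) x := fun x =>
    ((hV.differentiable one_ne_zero) x).hasFDerivAt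
  -- the two functions of Green's formula and their derivatives
  set f : ℝ × ℝ → ℝ := fun p => V (sqPt y₁ p) 1 with hf_def
  set g : ℝ × ℝ → ℝ := fun p => -(V (sqPt y₁ p) 0) with hg_def
  set f' : ℝ × ℝ → (ℝ × ℝ →L[ℝ] ℝ) := fun p =>
    (EuclideanSpace.proj (1 : Fin 3) : (EuclideanSpace ℝ (Fin 3)) →L[ℝ] ℝ).comp ((fderiv ℝ V (sqPt y₁ p)).comp sqL)
    with hf'_def
  set g' : ℝ × ℝ → (ℝ × ℝ →L[ℝ] ℝ) := fun p =>
    -((EuclideanSpace.proj (0 : Fin 3) : (EuclideanSpace ℝ (Fin 3)) →L[ℝ] ℝ).comp ((fderiv ℝ V (sqPt y₁ p)).comp sqL))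
    with hg'_def
  have hcomp : ∀ p, HasFDerivAt (V ∘ sqPt y₁) ((fderiv ℝ V (sqPt y₁ p)).comp sqL) p := fun p =>
    (hVd _).comp p (hasFDerivAt_sqPt y₁ p)
  have Hdf : ∀ p, HasFDerivAt f (f' p) p := fun p =>
    (EuclideanSpace.proj (1 : Fin 3) : (EuclideanSpace ℝ (Fin 3)) →L[ℝ] ℝ).hasFDerivAt.comp p (hcomp p)
  have Hdg : ∀ p, HasFDerivAt g (g' p) p := fun p =>
    ((EuclideanSpace.proj (0 : Fin 3) : (EuclideanSpace ℝ (Fin 3)) →L[ℝ] ℝ).hasFDerivAt.comp p (hcomp p)).neg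
  have hVc : Continuous (V ∘ sqPt y₁) := hV.continuous.comp (continuous_sqPt y₁)
  have Hcf : Continuous f := (EuclideanSpace.proj (1 : Fin 3) : (EuclideanSpace ℝ (Fin 3)) →L[ℝ] ℝ).continuous.comp hVc
  have Hcg : Continuous g := ((EuclideanSpace.proj (0 : Fin 3) : (EuclideanSpace ℝ (Fin 3)) →L[ℝ] ℝ).continuous.comp hVc).neg
  -- the integrand is the third curl component
  have hG : ∀ p, f' p (1, 0) + g' p (0, 1) = curl V (sqPt y₁ p) 2 := by
    intro p
    rw [show curl V (sqPt y₁ p) 2 = fderiv ℝ V (sqPt y₁ p) (EuclideanSpace.single 0 1) 1 -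
        fderiv ℝ V (sqPt y₁ p) (EuclideanSpace.single 1 1) 0 by simp [curl]]
    simp [hf'_def, hg'_def, sqL]
    ring
  have hcurlc : Continuous (curl V) := by
    have h : ContDiff ℝ ((0 : ℕ∞) + 1) V := by simpa using hV
    exact (contDiff_curl h).continuous
  have hGc : Continuous fun p : ℝ × ℝ => curl V (sqPt y₁ p) 2 :=
    (EuclideanSpace.proj (2 : Fin 3) : (EuclideanSpace ℝ (Fin 3)) →L[ℝ] ℝ).continuous.comp (hcurlc.comp (continuous_sqPt y₁))
  have Hi : IntegrableOn (fun p => f' p (1, 0) + g' p (0, 1)) (uIcc (-r) r ×ˢ uIcc (-r) r) volume := by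
    have : (fun p => f' p (1, 0) + g' p (0, 1)) = fun p => curl V (sqPt y₁ p) 2 := funext hG
    rw [this]
    exact hGc.continuousOn.integrableOn_compact (isCompact_uIcc.prod isCompact_uIcc)
  -- Green's formula on the square
  have hgreen := integral2_divergence_prod_of_hasFDerivAt f g f' g' (-r) (-r) r r
    Hcf.continuousOn Hcg.continuousOn (fun p _ => Hdf p) (fun p _ => Hdg p) Hi
  simp only [hG] at hgreen
  -- the volume side: `m (2r)²`
  have hin : ∀ x ∈ Icc (-r) r, 2 * r * m ≤ ∫ y in (-r)..r, curl V (sqPt y₁ (x, y)) 2 := by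
    intro x hx
    have hc : Continuous fun y : ℝ => curl V (sqPt y₁ (x, y)) 2 :=
      hGc.comp (continuous_const.prodMk continuous_id)
    have h := intervalIntegral.integral_mono_on (μ := volume) (by linarith : -r ≤ r)
      intervalIntegrable_const (hc.intervalIntegrable _ _) (fun y hy => hm (x, y) ⟨hx, hy⟩)
    rwa [intervalIntegral.integral_const, smul_eq_mul, show (r - -r) * m = 2 * r * m by ring] at h
  have hI : Continuous fun x : ℝ => ∫ y in (-r)..r, curl V (sqPt y₁ (x, y)) 2 :=
    intervalIntegral.continuous_parametric_intervalIntegral_of_continuous'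
      (f := fun x y => curl V (sqPt y₁ (x, y)) 2)
      (by exact hGc.comp (continuous_fst.prodMk continuous_snd)) (-r) r
  have hout : 2 * r * (2 * r * m) ≤ ∫ x in (-r)..r, ∫ y in (-r)..r, curl V (sqPt y₁ (x, y)) 2 := by
    have h := intervalIntegral.integral_mono_on (μ := volume) (by linarith : -r ≤ r)
      intervalIntegrable_const (hI.intervalIntegrable _ _) hin
    rwa [intervalIntegral.integral_const, smul_eq_mul,
      show (r - -r) * (2 * r * m) = 2 * r * (2 * r * m) by ring] at h
  -- the surface side: four edges, each `≤ 2 r K`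
  have hedge : ∀ h : ℝ → ℝ, (∀ x, |h x| ≤ K) → |∫ x in (-r)..r, h x| ≤ K * (2 * r) := by
    intro h hh
    have := intervalIntegral.norm_integral_le_of_norm_le_const (a := -r) (b := r) (C := K) (f := h)
      (fun x _ => by rw [Real.norm_eq_abs]; exact hh x)
    rwa [Real.norm_eq_abs, show |r - -r| = 2 * r by rw [abs_of_nonneg (by linarith)]; ring] at this
  have hVi := abs_apply_le_of_norm_le hK
  have e1 := hedge (fun x => g (x, r)) fun x => by rw [hg_def]; simp only [abs_neg]; exact hVi _ 0
  have e2 := hedge (fun x => g (x, -r)) fun x => by rw [hg_def]; simp only [abs_neg]; exact hVi _ 0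
  have e3 := hedge (fun y => f (r, y)) fun y => hVi _ 1
  have e4 := hedge (fun y => f (-r, y)) fun y => hVi _ 1
  rw [abs_le] at e1 e2 e3 e4
  have hm2 : m * (2 * r) ^ 2 = 2 * r * (2 * r * m) := by ring
  rw [hm2]
  linarith [e1.2, e2.1, e3.2, e4.1]

/-! ### A third curl component in the class of Lemma 2.1 is `≤ 0` -/

/-- **A third curl component of bounded `C¹` fields, lying in the class of Lemma 2.1, is `≤ 0`**
(KNSS 2009, proof of Theorem 5.1, p. 9, one dimension up: `f` bounded with `C²` slices, bounded
and jointly continuous `Df`, `Δf`, the integrated drift–diffusion equation with bounded measurable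
drift; if `M₁ = sup f > 0`, Lemma 2.1 (`KNSS2009_lemma21_halfball_holds`) gives parabolic balls of
every radius `R` on which `f ≥ M₁/2`; on the horizontal square of half-side `R/4` inside such a
ball the square flux bound `curlThird_square_bound` gives `M₁ R ≤ 16 K`, absurd for `R` large).
The difference from `directionalDeriv_nonpos_of_lemma21`: the slice is a third curl component
`∂₀V₁ − ∂₁V₀` of a bounded field, not a single directional derivative. [cite: KochNadirashviliSereginSverak2009, Lemma 2.1 (arXiv p. 5) and proof of Thm 5.1 (p. 9)] -/
theorem curlThird_nonpos_of_lemma21 {f : ℝ → (EuclideanSpace ℝ (Fin 3)) → ℝ} {a : ℝ → (EuclideanSpace ℝ (Fin 3)) → (EuclideanSpace ℝ (Fin 3))} {A K : ℝ}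
    (ha : Measurable (uncurry a)) (haA : ∀ t < 0, ∀ y, ‖a t y‖ ≤ A)
    (hfb : ∃ C : ℝ, ∀ t < 0, ∀ y, |f t y| ≤ C) (hf2 : ∀ t < 0, ContDiff ℝ 2 (f t))
    (hfD : ∃ C : ℝ, ∀ t < 0, ∀ y, ‖fderiv ℝ (f t) y‖ ≤ C ∧ |(Δ (f t)) y| ≤ C)
    (hcD : ContinuousOn (fun p : ℝ × (EuclideanSpace ℝ (Fin 3)) => fderiv ℝ (f p.1) p.2) (Iio 0 ×ˢ univ))
    (hcΔ : ContinuousOn (fun p : ℝ × (EuclideanSpace ℝ (Fin 3)) => (Δ (f p.1)) p.2) (Iio 0 ×ˢ univ))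
    (heq : ∀ y, ∀ s t : ℝ, s ≤ t → t < 0 →
      f t y - f s y = ∫ τ in s..t, ((Δ (f τ)) y - fderiv ℝ (f τ) y (a τ y)))
    (hrep : ∀ t < 0, ∃ V : (EuclideanSpace ℝ (Fin 3)) → (EuclideanSpace ℝ (Fin 3)), ContDiff ℝ 1 V ∧ (∀ x, ‖V x‖ ≤ K) ∧ ∀ x, f t x = curl V x 2) :
    ∀ t < 0, ∀ y, f t y ≤ 0 := by
  by_contra hcon
  push Not at hcon
  obtain ⟨t₀, ht₀, y₀, hy₀⟩ := hcon
  obtain ⟨C, hC⟩ := hfb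
  -- the set of values of `f` on the slab and its supremum `M₁ > 0`
  set S : Set ℝ := (fun p : ℝ × (EuclideanSpace ℝ (Fin 3)) => f p.1 p.2) '' (Iio (0 : ℝ) ×ˢ (univ : Set (EuclideanSpace ℝ (Fin 3)))) with hS
  have hbdd : BddAbove S := by
    refine ⟨C, ?_⟩
    rintro r ⟨⟨t, y⟩, ⟨ht, -⟩, rfl⟩
    exact (le_abs_self _).trans (hC t ht y)
  have hmem : ∀ t < 0, ∀ y, f t y ∈ S := fun t ht y => ⟨(t, y), ⟨ht, mem_univ _⟩, rfl⟩
  have hne : S.Nonempty := ⟨_, hmem t₀ ht₀ y₀⟩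
  set M₁ : ℝ := sSup S with hM₁
  have hle : ∀ t < 0, ∀ y, f t y ≤ M₁ := fun t ht y => le_csSup hbdd (hmem t ht y)
  have hpos : 0 < M₁ := hy₀.trans_le (hle t₀ ht₀ y₀)
  have happ : ∀ ε > 0, ∃ t < 0, ∃ y, M₁ - ε < f t y := by
    intro ε hε
    obtain ⟨r, ⟨⟨t, y⟩, ⟨ht, -⟩, rfl⟩, hr⟩ :=
      exists_lt_of_lt_csSup hne (by linarith : M₁ - ε < sSup S)
    exact ⟨t, ht, y, hr⟩
  -- Lemma 2.1: balls of every radius on which `f ≥ M₁ / 2`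
  have H := KNSS2009_lemma21_halfball_holds (E := (EuclideanSpace ℝ (Fin 3))) ha haA ⟨C, hC⟩ hf2 hfD hcD hcΔ heq hle happ hpos
  -- the radius for which the square flux bound fails
  set R : ℝ := (16 * |K| + 16) / M₁ with hR
  have hRpos : 0 < R := by positivity
  obtain ⟨y₁, t₁, ht₁, hball⟩ := H R hRpos
  have ht₂ : t₁ - R ^ 2 / 2 ∈ Ioo (t₁ - R ^ 2) t₁ := by
    constructor <;> nlinarith [sq_nonneg R, hRpos]
  have ht₂' : t₁ - R ^ 2 / 2 < 0 := by nlinarith [sq_nonneg R]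
  obtain ⟨V, hV, hVK, hfV⟩ := hrep _ ht₂'
  -- the horizontal square of half-side `R/4` through `y₁` lies in the ball
  have hmemB : ∀ p ∈ Icc (-(R / 4)) (R / 4) ×ˢ Icc (-(R / 4)) (R / 4), sqPt y₁ p ∈ Metric.ball y₁ R := by
    rintro ⟨a, b⟩ ⟨ha', hb'⟩
    rw [Metric.mem_ball, dist_eq_norm, sqPt, add_assoc, add_sub_cancel_left]
    have h0 : ‖(EuclideanSpace.single (0 : Fin 3) (1 : ℝ) : (EuclideanSpace ℝ (Fin 3)))‖ = 1 := by simp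
    have h1 : ‖(EuclideanSpace.single (1 : Fin 3) (1 : ℝ) : (EuclideanSpace ℝ (Fin 3)))‖ = 1 := by simp
    have hab : |a| ≤ R / 4 ∧ |b| ≤ R / 4 := ⟨abs_le.2 ⟨ha'.1, ha'.2⟩, abs_le.2 ⟨hb'.1, hb'.2⟩⟩
    calc ‖a • (EuclideanSpace.single (0 : Fin 3) (1 : ℝ) : (EuclideanSpace ℝ (Fin 3))) + b • EuclideanSpace.single 1 (1 : ℝ)‖
        ≤ ‖a • (EuclideanSpace.single (0 : Fin 3) (1 : ℝ) : (EuclideanSpace ℝ (Fin 3)))‖ + ‖b • (EuclideanSpace.single (1 : Fin 3) (1 : ℝ) : (EuclideanSpace ℝ (Fin 3)))‖ :=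
          norm_add_le _ _
      _ = |a| + |b| := by rw [norm_smul, norm_smul, h0, h1, mul_one, mul_one, Real.norm_eq_abs, Real.norm_eq_abs]
      _ < R := by linarith [hab.1, hab.2]
  have hsq : ∀ p ∈ Icc (-(R / 4)) (R / 4) ×ˢ Icc (-(R / 4)) (R / 4), M₁ / 2 ≤ curl V (sqPt y₁ p) 2 :=
    fun p hp => by rw [← hfV]; exact hball _ ht₂ _ (hmemB p hp)
  have key := curlThird_square_bound hV hVK (by positivity : (0 : ℝ) ≤ R / 4) hsq
  -- `M₁ R² / 8 ≤ 2 K R`, i.e. `M₁ R ≤ 16 K`, while `M₁ R = 16 |K| + 16`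
  have h1 : M₁ * R ≤ 16 * K := by
    have h : M₁ * R * R ≤ 16 * K * R := by nlinarith [key]
    exact le_of_mul_le_mul_right h hRpos
  have h2 : M₁ * R = 16 * |K| + 16 := by
    rw [hR]
    field_simp
  linarith [le_abs_self K]

end B1

end Summit.NavierStokesRegularity.NavierStokesRegularity.Theorems.ScenarioCensus.HorizontalMeter

end
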